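import Mathlib
import Summits.Ventures.PercRepro2.Defs
import Summits.Ventures.PercRepro2.Independence
import Summits.Ventures.PercRepro2.Harris
import Summits.Ventures.PercRepro2.Graph
import Summits.Ventures.PercRepro2.Exploration
import Summits.Ventures.PercRepro2.Events
import Summits.Ventures.PercRepro2.FourFunctions
import Summits.Ventures.PercRepro2.Induced
import Summits.Ventures.PercRepro2.Frontier
import Summits.Ventures.PercRepro2.ObsIndependence
import Summits.Ventures.PercRepro2.BHK
import Summits.Ventures.PercRepro2.BHKEvents
import Summits.Ventures.PercRepro2.BHKAvoid
import Summits.Ventures.PercRepro2.SameClusterAvoid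

/-!
# The given-T BHK parts of PATHMIX / (PATH): BHK at the modified weight vector of an exploration
record (blind cell PercRepro2, p1 g13; ASSIGNMENTS v12.49 «p1: the given-T BHK parts … as a lemma
over typer-1's T once typed»; lead g24 INBOX 00:15Z «the given-T BHK part needs NO contraction —
it is `bhk_same_cluster_events_avoid` at a MODIFIED WEIGHT VECTOR»)

An exploration record `T = (T⁺, T⁻)` (explored edges found open / closed) conditions the product
law to the cylinder; on the cylinder the law is the PRODUCT law with the modified weights
**`modWeights p T⁺ T⁻ = p[e ↦ 1 on T⁺, e ↦ 0 on T⁻]`** (**`isProbVec_modWeights`**), and — when `T⁺` is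
a connected set of open edges containing `a₁` (the first path to `a₃`) — «`C(a₂)` avoids `V(T)`» is
«`C(a₂)` avoids `{a₁}`», i.e. the plain `Q = {a₁ ↮ a₂}`. Hence the two within-record covariances of
PATHMIX / Lemma (S) are the tree's BHK theorems AT `modWeights`, for every record:

* **`givenT_same_cluster`** (the (ii)-side, `Cov(b ∈ C₂, o ∈ C₂ ∣ T) ≥ 0`): BHK 1.3 with set
  avoidance `{a₁}` at `modWeights` (`bhk_same_cluster_events_avoid`), multiplied out;
* **`givenT_cross_cluster`** (the (i)-side, `Cov(b ∈ C₁, o ∈ C₂ ∣ T) ≤ 0`): BHK 1.4 at `modWeights`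
  (`bhk_cross_cluster`), multiplied out;
* (the FUNCTIONAL form `bhk_cross_cluster_fun` of `CaseOneRegime.lean` is not needed here — the
  (PATH) within-part uses only events of `C₂`).

What remains for a kernel (PATH) / PATHMIX is typer-1's DISINTEGRATION `P(· ∩ Q) = Σ_T P(cyl T) ·
P_{modWeights T}(· ∩ Q)` over the exploration records (a stopping set) and the law of total
covariance; with it, `(ii) = Σ_T w_T · Cov_{modWeights T}(b ∈ C₂, o ∈ C₂ ∣ Q) + PM` and the BHK part
is `givenT_same_cluster` termwise. Nothing beyond the two BHK instances is claimed here. -/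

namespace Summit.Ventures.PercRepro2

namespace PathMix

section Weights
variable {E : Type*} [DecidableEq E] {R : Type*} [CommRing R] [LinearOrder R] [IsStrictOrderedRing R]

/-- **The modified weight vector of an exploration record**: `1` on the explored-open edges `T⁺`,
`0` on the explored-closed edges `T⁻`, `p` elsewhere. -/
def modWeights (p : E → R) (Tplus Tminus : Finset E) : E → R :=
  fun e => if e ∈ Tplus then 1 else if e ∈ Tminus then 0 else p e

/-- `modWeights` is a probability vector. -/
theorem isProbVec_modWeights {p : E → R} (hp : IsProbVec p) (Tplus Tminus : Finset E) :
    IsProbVec (modWeights p Tplus Tminus) := by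
  refine ⟨fun e => ?_, fun e => ?_⟩
  · unfold modWeights
    split_ifs
    · exact zero_le_one
    · exact le_rfl
    · exact hp.nonneg e
  · unfold modWeights
    split_ifs
    · exact le_rfl
    · exact zero_le_one
    · exact hp.le_one e

omit [LinearOrder R] [IsStrictOrderedRing R] in
/-- On `T⁺` the modified weight is `1`. -/
lemma modWeights_of_mem_plus (p : E → R) {Tplus Tminus : Finset E} {e : E} (h : e ∈ Tplus) :
    modWeights p Tplus Tminus e = 1 := by
  simp [modWeights, h]

omit [LinearOrder R] [IsStrictOrderedRing R] in
/-- On `T⁻ ∖ T⁺` the modified weight is `0`. -/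
lemma modWeights_of_mem_minus (p : E → R) {Tplus Tminus : Finset E} {e : E} (h : e ∈ Tminus)
    (h' : e ∉ Tplus) : modWeights p Tplus Tminus e = 0 := by
  simp [modWeights, h, h']

omit [LinearOrder R] [IsStrictOrderedRing R] in
/-- Off the record the modified weight is `p`. -/
lemma modWeights_of_notMem (p : E → R) {Tplus Tminus : Finset E} {e : E} (h : e ∉ Tplus)
    (h' : e ∉ Tminus) : modWeights p Tplus Tminus e = p e := by
  simp [modWeights, h, h']

end Weights

section BHK
variable {V : Type*} {E : Type*} [Fintype E] [DecidableEq E] [Fintype V] [DecidableEq V]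
  {R : Type*} [CommRing R] [LinearOrder R] [IsStrictOrderedRing R]

omit [Fintype V] [DecidableEq V] in
/-- `{S ∋ v}` is an up-set of vertex sets. -/
private lemma isUpperSet_mem₄ (v : V) : IsUpperSet {S : Set V | v ∈ S} :=
  fun _ _ h hv => h hv

omit [Fintype E] [DecidableEq E] [Fintype V] [DecidableEq V] in
/-- `{C(x) ∋ v}` is the connection event. -/
private lemma clusterInEvent_mem (ends : E → Sym2 V) (x v : V) :
    clusterInEvent ends x {S : Set V | v ∈ S} = connEvent ends x v := by
  ext ω
  simp [clusterInEvent, connEvent]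

omit [Fintype E] [DecidableEq E] [Fintype V] [DecidableEq V] in
/-- `{C(x) ∋ v, w}` is the intersection of two connection events. -/
private lemma clusterInEvent_mem_inter (ends : E → Sym2 V) (x v w : V) :
    clusterInEvent ends x ({S : Set V | v ∈ S} ∩ {S : Set V | w ∈ S}) =
      connEvent ends x v ∩ connEvent ends x w := by
  ext ω
  simp [clusterInEvent, connEvent]

omit [Fintype E] [DecidableEq E] [Fintype V] [DecidableEq V] in
/-- `{a₂ ↮ a₁}` as set avoidance of `{a₁}` by `a₂`. -/
private lemma avoidAll_singleton_eq (ends : E → Sym2 V) (a₁ a₂ : V) :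
    avoidAll ends a₂ {a₁} = (connEvent ends a₁ a₂)ᶜ := by
  ext ω
  simp [avoidAll, connEvent, Conn]
  constructor
  · intro h h'; exact h (conn_symm h')
  · intro h h'; exact h (conn_symm h')

/-- **The (ii)-side given-record BHK part**: at the modified weights of ANY record `(T⁺, T⁻)`,
`P(b, o ∈ C₂, Q) · P(Q) ≥ P(b ∈ C₂, Q) · P(o ∈ C₂, Q)` — `Cov_{p_T}(1[b ∈ C₂], 1[o ∈ C₂] ∣ Q) ≥ 0`
(BHK 1.3 with the avoided set `{a₁}`, `bhk_same_cluster_events_avoid`). -/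
theorem givenT_same_cluster (p : E → R) (hp : IsProbVec p) (ends : E → Sym2 V) (o a₁ a₂ b : V)
    (Tplus Tminus : Finset E) :
    prob (modWeights p Tplus Tminus) (connEvent ends a₂ b ∩ (connEvent ends a₁ a₂)ᶜ) *
        prob (modWeights p Tplus Tminus) (connEvent ends a₂ o ∩ (connEvent ends a₁ a₂)ᶜ) ≤
      prob (modWeights p Tplus Tminus)
          (connEvent ends a₂ b ∩ connEvent ends a₂ o ∩ (connEvent ends a₁ a₂)ᶜ) *
        prob (modWeights p Tplus Tminus) (connEvent ends a₁ a₂)ᶜ := by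
  have h := bhk_same_cluster_events_avoid (modWeights p Tplus Tminus)
    (isProbVec_modWeights hp Tplus Tminus) ends a₂ {a₁} (isUpperSet_mem₄ (V := V) b)
    (isUpperSet_mem₄ (V := V) o)
  rw [clusterInEvent_mem, clusterInEvent_mem, clusterInEvent_mem_inter, avoidAll_singleton_eq] at h
  exact h

/-- **The (i)-side given-record BHK part**: at the modified weights of ANY record,
`P(b ∈ C₁, o ∈ C₂, Q) · P(Q) ≤ P(b ∈ C₁, Q) · P(o ∈ C₂, Q)` — `Cov_{p_T}(1[b ∈ C₁], 1[o ∈ C₂] ∣ Q) ≤ 0`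
(BHK 1.4, `bhk_cross_cluster`). -/
theorem givenT_cross_cluster (p : E → R) (hp : IsProbVec p) (ends : E → Sym2 V) (o a₁ a₂ b : V)
    (Tplus Tminus : Finset E) :
    prob (modWeights p Tplus Tminus)
        (connEvent ends a₁ b ∩ connEvent ends a₂ o ∩ (connEvent ends a₁ a₂)ᶜ) *
        prob (modWeights p Tplus Tminus) (connEvent ends a₁ a₂)ᶜ ≤
      prob (modWeights p Tplus Tminus) (connEvent ends a₁ b ∩ (connEvent ends a₁ a₂)ᶜ) *
        prob (modWeights p Tplus Tminus) (connEvent ends a₂ o ∩ (connEvent ends a₁ a₂)ᶜ) := by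
  have h := bhk_cross_cluster (modWeights p Tplus Tminus) (isProbVec_modWeights hp Tplus Tminus)
    ends a₁ a₂ (isUpperSet_mem₄ (V := V) b) (isUpperSet_mem₄ (V := V) o)
  rw [clusterInEvent_mem, clusterInEvent_mem] at h
  exact h

end BHK

end PathMix

end Summit.Ventures.PercRepro2
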